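import Literature.AlgebraicGeometry.HodgeTheory.BettiHodgeClassesProductHodgeTateFactor
import Literature.AlgebraicGeometry.HodgeTheory.OddHypersurfaceHodgeConjecture
import HarnessLib

/-!
# Products with a factor whose cohomology is algebraic (`Nᵇ(Z) = H^{2b}(Z(ℂ); ℂ)` for all `b`, `H^{odd}(Z(ℂ); ℚ) = 0`), model-free on the lane's carriers:
# such a `Z` is of Hodge–Tate type and satisfies `HC(Z)`; `HC(Y) ⟹ HC(Y × Z)`; `dim_ℂ Nᵖ(Y × Z) ≥ Σ_{a+b=p} dim_ℂ Nᵃ(Y) · b_{2b}(Z)` with equality under `HC(Y)`;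
# `HC(Y) ⟹ HC(Y × S)` for `p_g(S) = q(S) = 0` and `HC(Y) ⟹ HC(Y × T)` for a Hodge–Tate threefold `T`
# (Arapura 2001 Lemma 9 / Cor. 10 / Remark 11; Voisin I §11.3.3 Thm. 11.38, Lemma 11.41, p. 287, Prop. 11.20; Voisin II proof of Prop. 9.20)

Family `hodge`, lane `lit-hodgefound` (Track 2 foundations library; Layers A1/A4), layer `Literature/AlgebraicGeometry/HodgeTheory`.  THEOREMS ONLY (no definition,
no named fact, no instance; D-0026 net debt `0`).  Sequel of the seat's g27-#1/#2/#3 (`BettiKunnethHodgeClassesAlgebraicClasses`, `BettiPicardNumberOfProducts`,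
`BettiHodgeClassesProductHodgeTateFactor`).  g27-#3 transferred the Hodge conjecture to a product with a factor of HODGE–TATE TYPE satisfying `HC`; here the hypothesis is put in
Arapura's form — the fibre's cohomology «is spanned by algebraic cycles»: `algebraicClasses Z b = ⊤` for every `b` (all of `H^{2b}(Z(ℂ); ℂ)` is in the span of cycle classes) and
`b_k(Z) = 0` for odd `k` — and it is PROVED that such a `Z` is of Hodge–Tate type (an algebraic class is of type `(b,b)`, Voisin I Prop. 11.20, so `H^{2b}(Z)` is purely of type `(b,b)`;
odd degrees are `0`) and satisfies `HC(Z)` tautologically, so that g27-#3 applies: **`HC(Y) ⟹ HC(Y ⊗ Z)`**.  This is the Literature twin, by the rank route of g26-#7 / g27-#1, of the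
Summit-side transfer `hodgeConjectureFor_tensor_of_left` (`Summits/HodgeConjecture/…/NoetherLefschetzOneUpSummitGrantedFourfoldsCohomologicallyAlgebraicTransfer.lean`, same
hypotheses with `Subsingleton (H^{2k+1}(Z(ℂ); ℂ))`), which Literature may not import.

THE PRINTS.  D. Arapura (2001) [Arapura2001HodgeCyclesModuli] (held text `paper:arxiv-math_0102070` p0004) Lemma 9: «Let `f : X → Y` be a morphism of smooth varieties which is a Zariski locally
trivial fiber bundle with fiber `F`.  Suppose that `F` is smooth and that `H_*(F)` is spanned by algebraic cycles.  Then `GHC(H_{i−2j}(Y), p−j)` for all `j` […] implies `GHC(H_i(X), p)`»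
(proof through `Hᵏ(X) = ⊕_{i+2j=k} Hⁱ(Y) ⊗ H^{2j}(F)`), Cor. 10: «Then the Hodge conjecture holds for `X` if it holds for `Y`», Remark 11: «If `F` has a cellular decomposition, then it satisfies
the hypothesis of the lemma.  Flag manifolds and nonsingular projective toric varieties have cellular decompositions».  C. Voisin (2002) [VoisinHodgeI2002] §11.1.2 Prop. 11.20 (the class of an
analytic cycle is of type `(p,p)`), §11.3.3 Thm. 11.38 / Lemma 11.41 (pp. 285–286) and p. 287.  C. Voisin (2003) [VoisinHodgeII2003] §9.2.4, proof of Prop. 9.20, first display («`[Z × Z'] =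
pr₁^*[Z] ∪ pr₂^*[Z']`»).  P. Deligne (2000) [Deligne2000] §1.

THE OBJECTS (all the tree's).  `algebraicClasses Z b = Nᵇ(Z) ⊆ H^{2b}(Z(ℂ); ℂ)`; `b_k(Z) = Module.finrank ℚ (bettiCohomology Z k)`; the lane's Hodge–Tate predicate
`∀ k p q, p + q = k → p ≠ q → h^{p,q}(Hᵏ(Z)) = 0`; `HodgeConjectureFor`; `[HodgeTensorFacts.{0, 0}]` as in g27-#1–#3.

WHAT IS PROVED.
* §1 ALGEBRAIC COHOMOLOGY ⟹ PURE TYPE: `BettiUniverse.hodgeClasses_hodge_eq_top_of_algebraicClasses_eq_top` (`Nᵇ(Z) = ⊤ ⟹ Hdgᵇ(H^{2b}(Z)) = ⊤`), `BettiUniverse.hodgeNumber_hodge_eq_zero_of_finrank_eq_zero`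
  (`b_k = 0 ⟹ h^{p,q}(Hᵏ) = 0`), **`BettiUniverse.hodgeTateType_of_forall_algebraicClasses_eq_top`** (algebraic even cohomology + vanishing odd cohomology ⟹ Hodge–Tate type),
  `HC(Z)` by the TREE's `hodgeConjectureFor_of_forall_algebraicClasses_eq_top` (`OddHypersurfaceHodgeConjecture`, reused, not restated), `BettiUniverse.finrank_algebraicClasses_eq_finrank_of_eq_top` (`dim_ℂ Nᵇ(Z) = b_{2b}(Z)`).
* §2 THE TRANSFER: **`BettiUniverse.hodgeConjectureFor_tensor_of_forall_algebraicClasses_eq_top_right`** (`HC(Y) ⟹ HC(Y ⊗ Z)`), the mirror `…_left` (`HC(Z) ⟹ HC(Y ⊗ Z)` for `Y` with algebraic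
  cohomology), the Summit-style spelling with `Subsingleton (H^{2k+1}(Z(ℂ); ℂ))` (`…_right'`), and UNCONDITIONALLY `HC(Y ⊗ Z)` for `dim Y ≤ 3` (`BettiUniverse.hodgeConjectureFor_tensor_of_le_three_of_forall_algebraicClasses_eq_top`).
* §3 THE COUNTS: **`dim_ℚ Hdgᵖ(H^{2p}(Y ⊗ Z)) = Σ_{a+b=p} dim_ℚ Hdgᵃ(H^{2a}(Y)) · b_{2b}(Z)`** (`BettiUniverse.finrank_hodgeClasses_hodge_tensor_of_forall_algebraicClasses_eq_top_right`, g27-#3 via §1),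
  **`Σ_{a+b=p} dim_ℂ Nᵃ(Y) · b_{2b}(Z) ≤ dim_ℂ Nᵖ(Y ⊗ Z) ≤ Σ_{a+b=p} dim_ℚ Hdgᵃ(H^{2a}(Y)) · b_{2b}(Z)`** (`BettiUniverse.sum_finrank_algebraicClasses_mul_finrank_le_tensor`,
  `BettiUniverse.finrank_algebraicClasses_tensor_le_sum`), hence **under `HC(Y)`: `dim_ℂ Nᵖ(Y ⊗ Z) = Σ_{a+b=p} dim_ℂ Nᵃ(Y) · b_{2b}(Z)`** (`BettiUniverse.finrank_algebraicClasses_tensor_eq_sum_of_hodgeConjectureFor`)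
  and unconditionally in codimension `1`: **`dim_ℂ N¹(Y ⊗ Z) = ρ(Y ⊗ Z) = ρ(Y) + b₂(Z)`** (`BettiUniverse.finrank_algebraicClasses_one_tensor_of_forall_algebraicClasses_eq_top`).
* §4 BY HODGE NUMBERS ALONE (g27-#3 + g24's Hodge–Tate criteria): **`HC(Y) ⟹ HC(Y ⊗ S)` for a surface `S` with `p_g(S) = q(S) = 0`** (`BettiUniverse.hodgeConjectureFor_tensor_surface_pg_q_zero`; Enriques,
  Godeaux, rational surfaces) and **`HC(Y) ⟹ HC(Y ⊗ T)` for a threefold `T` with `h^{1,0} = h^{2,0} = h^{3,0} = h^{1,2} = 0`** (`BettiUniverse.hodgeConjectureFor_tensor_threefold_hodgeTate`; `ℙ³`,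
  smooth quadric and other Hodge–Tate Fano threefolds, `V₂₂`).

DEVIATIONS / SCOPE.  `HC(Y ⊗ Z) ⟹ HC(Y)` is not here; non-trivial fibre bundles (Arapura's Lemma 9 proper) are not here; no variety is shown to have algebraic cohomology here (the tree has
`ℙᴺ` and Hodge–Tate varieties of dimension `≤ 3` through g24 `ofRatClass_mem_algebraicClasses_of_hodgeTateType_of_le_three`, re-keyed in §4).

## References
* [Arapura2001HodgeCyclesModuli] D. Arapura, *Hodge cycles on some moduli spaces*, arXiv:math/0102070 (2001) — Lemma 9, Cor. 10, Remark 11.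
* [VoisinHodgeI2002] C. Voisin, *Hodge Theory and Complex Algebraic Geometry I* (2002) — §11.1.2 Prop. 11.20; §11.3.3 Thm. 11.38, Lemma 11.41 (pp. 285–286), p. 287; Thm. 11.30; §6.1.3 Cor. 6.13.
* [VoisinHodgeII2003] C. Voisin, *Hodge Theory and Complex Algebraic Geometry II* (2003) — §9.2.4 proof of Prop. 9.20 (first display); §11.1.1.
* [Deligne2000] P. Deligne, *The Hodge conjecture* (Clay, 2000) — §1.
* [GreenGriffithsKerr2012] M. Green, P. Griffiths, M. Kerr, *Mumford–Tate Groups and Domains* (2012) — §I.A p. 33 (Hodge–Tate structures).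

## Provenance
Lane `lit-hodgefound` (Hodge path, Track 2), prover seat `lit-hodgefound-p29` (generation 27), self-proposed row g27-#4 (sequel of g27-#1/#2/#3).
-/

noncomputable section

open scoped TensorProduct
open CategoryTheory MonoidalCategory Module Finset
open Literature.AlgebraicTopology.SingularHomology
open Literature.Geometry.Kaehler

namespace Literature.AlgebraicGeometry.HodgeTheory

open Literature.AlgebraicGeometry.Motives
open Literature.AlgebraicGeometry.Motives.HodgeStructure

variable {m n d : ℕ} {X Y Z : SchemeOver ℂ}

/-- `dim_ℂ Hᵏ(X(ℂ); ℂ) = dim_ℚ Hᵏ(X(ℂ); ℚ)` for `X` smooth projective (universal coefficients, the tree's `ofRatClassBaseChangeEquiv`). [cite: HatcherAT2002, §3.1 Thm. 3.2 and §3.A Cor. 3A.6] -/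
private theorem finrank_complexBetti_eq_finrank_betti' (hX : IsSmoothProjective n X) (k : ℕ) :
    Module.finrank ℂ (complexBetti X k) = Module.finrank ℚ (bettiCohomology X k) := by
  haveI := BettiUniverse.finite hX k
  rw [← (ofRatClassBaseChangeEquiv hX k).finrank_eq, Module.finrank_baseChange]

/-! ### §1 Algebraic even cohomology and vanishing odd cohomology ⟹ Hodge–Tate type and `HC` -/

/-- **`Nᵇ(Z) = H^{2b}(Z(ℂ); ℂ) ⟹ Hdgᵇ(H^{2b}(Z)) = ⊤`**: if every class of degree `2b` is in the span of algebraic cycle classes then every rational class is a Hodge class (Prop. 11.20; g24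
`hodgeClasses_hodge_eq_top_of_forall_mem_algebraicClasses`). [cite: VoisinHodgeI2002, §11.1.2 Prop. 11.20 and §11.3.1 Def. 11.28] -/
theorem BettiUniverse.hodgeClasses_hodge_eq_top_of_algebraicClasses_eq_top (hHD : exists_isReal_hodgeModel) (hZ : IsSmoothProjective n Z) {b : ℕ}
    (hN : algebraicClasses Z b = ⊤) : (BettiUniverse.hodge hHD hZ (2 * b)).hodgeClasses b = ⊤ :=
  BettiUniverse.hodgeClasses_hodge_eq_top_of_forall_mem_algebraicClasses hHD hZ b fun v ↦ by rw [hN]; exact Submodule.mem_top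

/-- **`b_k(X) = 0 ⟹ h^{p,q}(Hᵏ(X)) = 0` for all `p + q = k`** (`b_k = Σ_{p+q=k} h^{p,q}`, g24 `finrank_bettiCohomology_eq_sum_hodgeNumber_hodge`). [cite: VoisinHodgeI2002, §6.1.3 Cor. 6.13] -/
theorem BettiUniverse.hodgeNumber_hodge_eq_zero_of_finrank_eq_zero (hHD : exists_isReal_hodgeModel) (hX : IsSmoothProjective n X) {k p q : ℕ} (hpq : p + q = k)
    (hk : Module.finrank ℚ (bettiCohomology X k) = 0) : (BettiUniverse.hodge hHD hX k).hodgeNumber p q = 0 := by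
  rw [BettiUniverse.finrank_bettiCohomology_eq_sum_hodgeNumber_hodge hHD hX k] at hk
  have h := Finset.sum_eq_zero_iff.1 hk p (Finset.mem_range.2 (by omega))
  rwa [show (k - p : ℕ) = q by omega] at h

/-- **A smooth projective variety whose even cohomology is algebraic (`Nᵇ(Z) = H^{2b}(Z(ℂ); ℂ)` for all `b`) and whose odd Betti numbers vanish is of Hodge–Tate type**: `H^{2b}(Z)` is purely of
type `(b,b)` (an algebraic class is of type `(b,b)`, Prop. 11.20; the tree's `hodgeNumber_eq_zero_of_hodgeClasses_eq_top`) and the odd degrees are `0` — e.g. flag manifolds and smooth projective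
toric varieties («cellular decompositions», Arapura's Remark 11). [cite: VoisinHodgeI2002, §11.1.2 Prop. 11.20 and §6.1.3 Cor. 6.13] [cite: Arapura2001HodgeCyclesModuli, Remark 11]
[cite: GreenGriffithsKerr2012, §I.A p. 33] -/
theorem BettiUniverse.hodgeTateType_of_forall_algebraicClasses_eq_top (hHD : exists_isReal_hodgeModel) (hZ : IsSmoothProjective n Z) (hN : ∀ b : ℕ, algebraicClasses Z b = ⊤)
    (hodd : ∀ k : ℕ, Odd k → Module.finrank ℚ (bettiCohomology Z k) = 0) :
    ∀ k p q : ℕ, p + q = k → p ≠ q → (BettiUniverse.hodge hHD hZ k).hodgeNumber p q = 0 := by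
  intro k p q hpq hne
  rcases Nat.even_or_odd k with ⟨b, hb⟩ | hk
  · -- even degree `k = 2b`: `Hdgᵇ = ⊤`, so `h^{p,q} = 0` for `p ≠ b` (and `p ≠ b` since `p ≠ q`, `p + q = 2b`)
    obtain rfl : k = 2 * b := by omega
    haveI := BettiUniverse.finite hZ (2 * b)
    exact (BettiUniverse.hodge hHD hZ (2 * b)).hodgeNumber_eq_zero_of_hodgeClasses_eq_top (p := (b : ℤ)) (by push_cast; ring)
      (BettiUniverse.hodgeClasses_hodge_eq_top_of_algebraicClasses_eq_top hHD hZ (hN b)) (p' := (p : ℤ)) (q' := (q : ℤ)) (by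
        intro h
        have : p = b := by exact_mod_cast h
        omega)
  · exact BettiUniverse.hodgeNumber_hodge_eq_zero_of_finrank_eq_zero hHD hZ hpq (hodd k hk)

/-- **`Nᵇ(Z) = ⊤ ⟹ dim_ℂ Nᵇ(Z) = b_{2b}(Z)`.** [cite: VoisinHodgeI2002, §7.1.1 and §11.1.2] [cite: HatcherAT2002, §3.1 Thm. 3.2 and §3.A Cor. 3A.6] -/
theorem BettiUniverse.finrank_algebraicClasses_eq_finrank_of_eq_top (hZ : IsSmoothProjective n Z) {b : ℕ} (hN : algebraicClasses Z b = ⊤) :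
    Module.finrank ℂ ↥(algebraicClasses Z b) = Module.finrank ℚ (bettiCohomology Z (2 * b)) := by
  rw [hN, finrank_top, finrank_complexBetti_eq_finrank_betti' hZ (2 * b)]

/-- Odd-degree vanishing from the Summit-style hypothesis `Subsingleton (H^{2k+1}(Z(ℂ); ℂ))`: `b_k(Z) = 0` for every odd `k`. [cite: HatcherAT2002, §3.1 Thm. 3.2 and §3.A Cor. 3A.6] -/
theorem BettiUniverse.finrank_bettiCohomology_eq_zero_of_subsingleton_odd (hZ : IsSmoothProjective n Z) (hodd : ∀ k : ℕ, Subsingleton (complexBetti Z (2 * k + 1))) {k : ℕ}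
    (hk : Odd k) : Module.finrank ℚ (bettiCohomology Z k) = 0 := by
  obtain ⟨j, rfl⟩ := hk
  haveI := hodd j
  rw [← finrank_complexBetti_eq_finrank_betti' hZ (2 * j + 1)]
  exact Module.finrank_zero_of_subsingleton

/-- **`Σ_{a+b=p} dim_ℂ Nᵃ(Y) · b_{2b}(Z) ≤ dim_ℂ Nᵖ(Y ⊗ Z)`** for `Z` with algebraic even cohomology (g27-#1's exterior-product bound with `dim_ℂ Nᵇ(Z) = b_{2b}(Z)`).
[cite: VoisinHodgeII2003, §9.2.4 proof of Prop. 9.20 (first display)] [cite: VoisinHodgeI2002, §11.3.3 Thm. 11.38] -/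
theorem BettiUniverse.sum_finrank_algebraicClasses_mul_finrank_le_tensor (hY : IsSmoothProjective m Y) (hZ : IsSmoothProjective n Z) (hN : ∀ b : ℕ, algebraicClasses Z b = ⊤) (p : ℕ) :
    ∑ ab ∈ antidiagonal p, Module.finrank ℂ ↥(algebraicClasses Y ab.1) * Module.finrank ℚ (bettiCohomology Z (2 * ab.2)) ≤ Module.finrank ℂ ↥(algebraicClasses (Y ⊗ Z) p) := by
  have h := BettiUniverse.sum_finrank_algebraicClasses_mul_le_finrank_algebraicClasses_tensor hY hZ p
  refine le_trans (le_of_eq (Finset.sum_congr rfl fun ab _ ↦ ?_)) h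
  rw [BettiUniverse.finrank_algebraicClasses_eq_finrank_of_eq_top hZ (hN ab.2)]

section Transfer

variable [HodgeTensorFacts.{0, 0}]

/-! ### §2 The transfer `HC(Y) ⟹ HC(Y ⊗ Z)` -/

/-- **`HC(Y) ⟹ HC(Y ⊗ Z)` for a factor `Z` with algebraic even cohomology and vanishing odd cohomology** (Arapura's Cor. 10 for the trivial bundle `Y × Z → Y`; any smooth-projective structure on the
product): `Z` is of Hodge–Tate type and satisfies `HC` (§1), so g27-#3's `hodgeConjectureFor_tensor_of_hodgeTateType_right` applies.  Literature twin of the Summit-side `hodgeConjectureFor_tensor_of_left`.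
[cite: Arapura2001HodgeCyclesModuli, Lemma 9, Cor. 10 and Remark 11] [cite: VoisinHodgeI2002, §11.3.3 Thm. 11.38, Lemma 11.41 and p. 287] [cite: VoisinHodgeII2003, §9.2.4 proof of Prop. 9.20 (first display)] -/
theorem BettiUniverse.hodgeConjectureFor_tensor_of_forall_algebraicClasses_eq_top_right (hHD : exists_isReal_hodgeModel) (hY : IsSmoothProjective m Y) (hZ : IsSmoothProjective n Z)
    (hYZ : IsSmoothProjective d (Y ⊗ Z)) (hN : ∀ b : ℕ, algebraicClasses Z b = ⊤) (hodd : ∀ k : ℕ, Odd k → Module.finrank ℚ (bettiCohomology Z k) = 0)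
    (hHY : HodgeConjectureFor m Y) : HodgeConjectureFor d (Y ⊗ Z) :=
  BettiUniverse.hodgeConjectureFor_tensor_of_hodgeTateType_right hHD hY hZ hYZ (BettiUniverse.hodgeTateType_of_forall_algebraicClasses_eq_top hHD hZ hN hodd) hHY
    (hodgeConjectureFor_of_forall_algebraicClasses_eq_top hHD hZ hN)

/-- **`HC(Z) ⟹ HC(Y ⊗ Z)` for a factor `Y` with algebraic even cohomology and vanishing odd cohomology** (the mirror). [cite: Arapura2001HodgeCyclesModuli, Lemma 9, Cor. 10 and Remark 11]
[cite: VoisinHodgeI2002, §11.3.3 Thm. 11.38, Lemma 11.41 and p. 287] -/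
theorem BettiUniverse.hodgeConjectureFor_tensor_of_forall_algebraicClasses_eq_top_left (hHD : exists_isReal_hodgeModel) (hY : IsSmoothProjective m Y) (hZ : IsSmoothProjective n Z)
    (hYZ : IsSmoothProjective d (Y ⊗ Z)) (hN : ∀ a : ℕ, algebraicClasses Y a = ⊤) (hodd : ∀ k : ℕ, Odd k → Module.finrank ℚ (bettiCohomology Y k) = 0)
    (hHZ : HodgeConjectureFor n Z) : HodgeConjectureFor d (Y ⊗ Z) :=
  BettiUniverse.hodgeConjectureFor_tensor_of_hodgeTateType_left hHD hY hZ hYZ (BettiUniverse.hodgeTateType_of_forall_algebraicClasses_eq_top hHD hY hN hodd)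
    (hodgeConjectureFor_of_forall_algebraicClasses_eq_top hHD hY hN) hHZ

/-- **`HC(Y) ⟹ HC(Y ⊗ Z)`, Summit-style hypotheses**: `Nᵇ(Z) = ⊤` for all `b` and `Subsingleton (H^{2k+1}(Z(ℂ); ℂ))` for all `k` (exactly the hypotheses of the Summit-side
`hodgeConjectureFor_tensor_of_left`, here for any smooth-projective structure on the product). [cite: Arapura2001HodgeCyclesModuli, Cor. 10 and Remark 11] [cite: VoisinHodgeI2002, §11.3.3 Lemma 11.41] -/
theorem BettiUniverse.hodgeConjectureFor_tensor_of_forall_algebraicClasses_eq_top_right' (hHD : exists_isReal_hodgeModel) (hY : IsSmoothProjective m Y) (hZ : IsSmoothProjective n Z)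
    (hYZ : IsSmoothProjective d (Y ⊗ Z)) (hN : ∀ b : ℕ, algebraicClasses Z b = ⊤) (hodd : ∀ k : ℕ, Subsingleton (complexBetti Z (2 * k + 1)))
    (hHY : HodgeConjectureFor m Y) : HodgeConjectureFor d (Y ⊗ Z) :=
  BettiUniverse.hodgeConjectureFor_tensor_of_forall_algebraicClasses_eq_top_right hHD hY hZ hYZ hN
    (fun _ hk ↦ BettiUniverse.finrank_bettiCohomology_eq_zero_of_subsingleton_odd hZ hodd hk) hHY

/-- **UNCONDITIONAL: `HC(Y ⊗ Z)` for `dim Y ≤ 3` and `Z` with algebraic even cohomology and vanishing odd cohomology** (the Hodge conjecture holds in dimension `≤ 3`).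
[cite: Arapura2001HodgeCyclesModuli, Cor. 10 and Remark 11] [cite: VoisinHodgeI2002, Thm. 11.30, §6.2.3 Thm. 6.25 and §11.3.3] -/
theorem BettiUniverse.hodgeConjectureFor_tensor_of_le_three_of_forall_algebraicClasses_eq_top (hHD : exists_isReal_hodgeModel) (hY : IsSmoothProjective m Y)
    (hZ : IsSmoothProjective n Z) (hYZ : IsSmoothProjective d (Y ⊗ Z)) (hm : m ≤ 3) (hN : ∀ b : ℕ, algebraicClasses Z b = ⊤)
    (hodd : ∀ k : ℕ, Odd k → Module.finrank ℚ (bettiCohomology Z k) = 0) : HodgeConjectureFor d (Y ⊗ Z) :=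
  BettiUniverse.hodgeConjectureFor_tensor_of_forall_algebraicClasses_eq_top_right hHD hY hZ hYZ hN hodd (hodgeConjectureFor_of_dim_le_three_holds hm hY)

/-! ### §3 The counts -/

/-- **`dim_ℚ Hdgᵖ(H^{2p}(Y ⊗ Z)) = Σ_{a+b=p} dim_ℚ Hdgᵃ(H^{2a}(Y)) · b_{2b}(Z)`** for `Z` with algebraic even cohomology and vanishing odd cohomology (g27-#3's Hodge–Tate count, via §1).
[cite: VoisinHodgeI2002, §11.3.3 Thm. 11.38, Lemma 11.41 (pp. 285–286) and p. 287] [cite: Arapura2001HodgeCyclesModuli, Lemma 9] -/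
theorem BettiUniverse.finrank_hodgeClasses_hodge_tensor_of_forall_algebraicClasses_eq_top_right (hHD : exists_isReal_hodgeModel) (hY : IsSmoothProjective m Y)
    (hZ : IsSmoothProjective n Z) (hYZ : IsSmoothProjective d (Y ⊗ Z)) (hN : ∀ b : ℕ, algebraicClasses Z b = ⊤)
    (hodd : ∀ k : ℕ, Odd k → Module.finrank ℚ (bettiCohomology Z k) = 0) (p : ℕ) :
    Module.finrank ℚ ↥((BettiUniverse.hodge hHD hYZ (2 * p)).hodgeClasses p) =
      ∑ ab ∈ antidiagonal p, Module.finrank ℚ ↥((BettiUniverse.hodge hHD hY (2 * ab.1)).hodgeClasses ab.1) * Module.finrank ℚ (bettiCohomology Z (2 * ab.2)) :=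
  BettiUniverse.finrank_hodgeClasses_hodge_tensor_of_hodgeTateType_right hHD hY hZ hYZ (BettiUniverse.hodgeTateType_of_forall_algebraicClasses_eq_top hHD hZ hN hodd) p

/-- **`dim_ℂ Nᵖ(Y ⊗ Z) ≤ Σ_{a+b=p} dim_ℚ Hdgᵃ(H^{2a}(Y)) · b_{2b}(Z)`** for `Z` with algebraic even cohomology and vanishing odd cohomology (`dim_ℂ Nᵖ ≤ dim_ℚ Hdgᵖ`, g26-#7, and the count).
[cite: VoisinHodgeI2002, §11.1.2 Prop. 11.20, §11.3.3 Thm. 11.38 and p. 287] -/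
theorem BettiUniverse.finrank_algebraicClasses_tensor_le_sum (hHD : exists_isReal_hodgeModel) (hY : IsSmoothProjective m Y) (hZ : IsSmoothProjective n Z)
    (hYZ : IsSmoothProjective d (Y ⊗ Z)) (hN : ∀ b : ℕ, algebraicClasses Z b = ⊤) (hodd : ∀ k : ℕ, Odd k → Module.finrank ℚ (bettiCohomology Z k) = 0) (p : ℕ) :
    Module.finrank ℂ ↥(algebraicClasses (Y ⊗ Z) p) ≤
      ∑ ab ∈ antidiagonal p, Module.finrank ℚ ↥((BettiUniverse.hodge hHD hY (2 * ab.1)).hodgeClasses ab.1) * Module.finrank ℚ (bettiCohomology Z (2 * ab.2)) := by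
  rw [← BettiUniverse.finrank_hodgeClasses_hodge_tensor_of_forall_algebraicClasses_eq_top_right hHD hY hZ hYZ hN hodd p]
  exact BettiUniverse.finrank_algebraicClasses_le_finrank_hodgeClasses_hodge hHD hYZ p

/-- **Under `HC(Y)`: `dim_ℂ Nᵖ(Y ⊗ Z) = Σ_{a+b=p} dim_ℂ Nᵃ(Y) · b_{2b}(Z)`** for `Z` with algebraic even cohomology and vanishing odd cohomology — the algebraic classes of the product are exactly the
exterior products `Nᵃ(Y) ⊗ H^{2b}(Z)` counted along Künneth (the sandwich of the two previous bounds closes since `dim_ℂ Nᵃ(Y) = dim_ℚ Hdgᵃ(H^{2a}(Y))` under `HC(Y)`, g26-#7).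
[cite: Arapura2001HodgeCyclesModuli, Lemma 9 and Cor. 10] [cite: VoisinHodgeII2003, §9.2.4 proof of Prop. 9.20 (first display)] [cite: VoisinHodgeI2002, §11.3.3 Thm. 11.38 and p. 287] -/
theorem BettiUniverse.finrank_algebraicClasses_tensor_eq_sum_of_hodgeConjectureFor (hHD : exists_isReal_hodgeModel) (hY : IsSmoothProjective m Y) (hZ : IsSmoothProjective n Z)
    (hYZ : IsSmoothProjective d (Y ⊗ Z)) (hN : ∀ b : ℕ, algebraicClasses Z b = ⊤) (hodd : ∀ k : ℕ, Odd k → Module.finrank ℚ (bettiCohomology Z k) = 0)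
    (hHY : HodgeConjectureFor m Y) (p : ℕ) :
    Module.finrank ℂ ↥(algebraicClasses (Y ⊗ Z) p) = ∑ ab ∈ antidiagonal p, Module.finrank ℂ ↥(algebraicClasses Y ab.1) * Module.finrank ℚ (bettiCohomology Z (2 * ab.2)) := by
  refine le_antisymm ?_ (BettiUniverse.sum_finrank_algebraicClasses_mul_finrank_le_tensor hY hZ hN p)
  refine (BettiUniverse.finrank_algebraicClasses_tensor_le_sum hHD hY hZ hYZ hN hodd p).trans (le_of_eq (Finset.sum_congr rfl fun ab _ ↦ ?_))
  rw [(BettiUniverse.hodgeConjectureFor_iff_forall_finrank_algebraicClasses_eq hHD hY).1 hHY ab.1]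

/-- **`dim_ℂ N¹(Y ⊗ Z) = ρ(Y) + b₂(Z)` unconditionally** for `Z` with algebraic even cohomology and vanishing odd cohomology (`dim_ℂ N¹ = ρ` by Lefschetz `(1,1)`, g26-#7; `ρ(Y ⊗ Z) = ρ(Y) + b₂(Z)`,
g27-#3). [cite: VoisinHodgeI2002, Thm. 11.30 and §11.3.3 Lemma 11.41] [cite: HulekLaface2019PicardNumbersAV, §2.1 Prop. 2.2] -/
theorem BettiUniverse.finrank_algebraicClasses_one_tensor_of_forall_algebraicClasses_eq_top (hHD : exists_isReal_hodgeModel) (hY : IsSmoothProjective m Y)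
    (hZ : IsSmoothProjective n Z) (hYZ : IsSmoothProjective d (Y ⊗ Z)) (hN : ∀ b : ℕ, algebraicClasses Z b = ⊤)
    (hodd : ∀ k : ℕ, Odd k → Module.finrank ℚ (bettiCohomology Z k) = 0) :
    Module.finrank ℂ ↥(algebraicClasses (Y ⊗ Z) 1) = Module.finrank ℚ ↥((BettiUniverse.hodge hHD hY 2).hodgeClasses 1) + Module.finrank ℚ (bettiCohomology Z 2) := by
  rw [BettiUniverse.finrank_algebraicClasses_one_eq_finrank_hodgeClasses_hodge hHD hYZ,
    ← BettiUniverse.picardNumber_tensor_of_hodgeTateType_right hHD hY hZ hYZ (BettiUniverse.hodgeTateType_of_forall_algebraicClasses_eq_top hHD hZ hN hodd)]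

/-! ### §4 By Hodge numbers alone: surfaces with `p_g = q = 0`, Hodge–Tate threefolds -/

/-- **`HC(Y) ⟹ HC(Y ⊗ S)` for a smooth projective surface `S` with `p_g(S) = q(S) = 0`** (Enriques, Godeaux, Campedelli, Burniat, rational surfaces …: `S` is of Hodge–Tate type and `HC(S)` holds, dimension
`2`; any `Y`, any smooth-projective structure on the product). [cite: VoisinHodgeII2003, §11.1.1 (PDF p. 268)] [cite: Arapura2001HodgeCyclesModuli, Cor. 10] [cite: VoisinHodgeI2002, §11.3.3 Lemma 11.41] -/
theorem BettiUniverse.hodgeConjectureFor_tensor_surface_pg_q_zero (hHD : exists_isReal_hodgeModel) (hY : IsSmoothProjective m Y) {S : SchemeOver ℂ} (hS : IsSmoothProjective 2 S)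
    (hYS : IsSmoothProjective d (Y ⊗ S)) (h10 : (BettiUniverse.hodge hHD hS 1).hodgeNumber 1 0 = 0) (h20 : (BettiUniverse.hodge hHD hS 2).hodgeNumber 2 0 = 0)
    (hHY : HodgeConjectureFor m Y) : HodgeConjectureFor d (Y ⊗ S) :=
  BettiUniverse.hodgeConjectureFor_tensor_of_hodgeTateType_of_le_three_right hHD hY hS hYS (by norm_num) (BettiUniverse.hodgeTateType_of_surface_pg_q_zero hS hHD h10 h20) hHY

/-- **`HC(Y) ⟹ HC(Y ⊗ T)` for a smooth projective threefold `T` with `h^{1,0} = h^{2,0} = h^{3,0} = h^{1,2} = 0`** (a Hodge–Tate threefold: `ℙ³`, the quadric, `V₅`, `V₂₂`, …; `HC(T)` holds, dimension `3`).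
[cite: VoisinHodgeI2002, §6.1.3 Cor. 6.12, Thm. 11.30 and §11.3.3] [cite: Arapura2001HodgeCyclesModuli, Cor. 10] [cite: GreenGriffithsKerr2012, §I.A p. 33] -/
theorem BettiUniverse.hodgeConjectureFor_tensor_threefold_hodgeTate (hHD : exists_isReal_hodgeModel) (hY : IsSmoothProjective m Y) {T : SchemeOver ℂ} (hT : IsSmoothProjective 3 T)
    (hYT : IsSmoothProjective d (Y ⊗ T)) (h10 : (BettiUniverse.hodge hHD hT 1).hodgeNumber 1 0 = 0) (h20 : (BettiUniverse.hodge hHD hT 2).hodgeNumber 2 0 = 0)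
    (h30 : (BettiUniverse.hodge hHD hT 3).hodgeNumber 3 0 = 0) (h12 : (BettiUniverse.hodge hHD hT 3).hodgeNumber 1 2 = 0) (hHY : HodgeConjectureFor m Y) :
    HodgeConjectureFor d (Y ⊗ T) :=
  BettiUniverse.hodgeConjectureFor_tensor_of_hodgeTateType_of_le_three_right hHD hY hT hYT le_rfl (BettiUniverse.hodgeTateType_of_threefold hT hHD h10 h20 h30 h12) hHY

/-- **`ρ(Y ⊗ S) = ρ(Y) + b₂(S)` for a surface `S` with `p_g(S) = q(S) = 0`** (e.g. `ρ(Y × Enriques) = ρ(Y) + 10`). [cite: VoisinHodgeII2003, §11.1.1 (PDF p. 268)]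
[cite: HulekLaface2019PicardNumbersAV, §2.1 Prop. 2.2] [cite: VoisinHodgeI2002, §11.3.3 Lemma 11.41] -/
theorem BettiUniverse.picardNumber_tensor_surface_pg_q_zero (hHD : exists_isReal_hodgeModel) (hY : IsSmoothProjective m Y) {S : SchemeOver ℂ} (hS : IsSmoothProjective 2 S)
    (hYS : IsSmoothProjective d (Y ⊗ S)) (h10 : (BettiUniverse.hodge hHD hS 1).hodgeNumber 1 0 = 0) (h20 : (BettiUniverse.hodge hHD hS 2).hodgeNumber 2 0 = 0) :
    Module.finrank ℚ ↥((BettiUniverse.hodge hHD hYS 2).hodgeClasses 1) =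
      Module.finrank ℚ ↥((BettiUniverse.hodge hHD hY 2).hodgeClasses 1) + Module.finrank ℚ (bettiCohomology S 2) :=
  BettiUniverse.picardNumber_tensor_of_hodgeTateType_right hHD hY hS hYS (BettiUniverse.hodgeTateType_of_surface_pg_q_zero hS hHD h10 h20)

end Transfer

end Literature.AlgebraicGeometry.HodgeTheory

end
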